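import Literature.LinearAlgebra.Matrix.CirculantPseudoinverseDFT
import Literature.LinearAlgebra.TensorNetworks.QTTLaplacePseudoinverse

/-!
# The periodic Laplacian pseudoinverse in Fourier form and the trigonometric identities of
# Plonka–Hoffmann–Weickert 2016, Corollary 2.4

Source.  G. Plonka, S. Hoffmann, J. Weickert, *Pseudo-inverses of difference matrices and their
application to sparse signal approximation*, Linear Algebra Appl. 503 (2016) 26–47,
arXiv:1504.04266 [PlonkaHoffmannWeickert2016] (held text `paper:arxiv-1504.04266`, §2,
Corollary 2.4 and its proof, p. 5 of the arXiv text).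
Builds on `TensorNetworks.QTTLaplacePseudoinverse` (PHW16 Theorems 2.2–2.3 in closed form:
`laplaceP_eq_circulant`, `pinv_laplaceP_apply`, `pinv_laplaceP_sq`) and
`Matrix.CirculantPseudoinverseDFT` (the proof of Corollary 2.4 at the level of the circulant
`circ(2, −1, 0, …, 0, −1) = circulant (cycleLapVec ℂ N)`:
`pinv_circulant_cycleLapVec_eq_fourier_conj`, `pinv_circulant_cycleLapVec_apply_zero`, …).
This file identifies `Δ = laplaceP ℂ N` with that circulant and carries out PHW's final
"comparison of the entries in the first column", which IS Corollary 2.4.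

## The statement (verbatim, [PHW16, Corollary 2.4, arXiv p. 5])

"For `N ∈ ℕ` we have
`Σ_{k=1}^{N−1} cos(2πkj/N) / sin²(kπ/N) = (N² − 1)/3 − 2j(N − j)`, `j = 0, …, N − 1`,
`Σ_{k=1}^{N−1} cos(2πkj/N) / sin⁴(kπ/N) = (N² − 1)(N² + 11)/45 − 2j(N − j)(Nj − j² + 2)/3`,
`j = 0, …, N − 1`,
`Σ_{k=1}^{N−1} sin(2πkj/N) / sin²(kπ/N) = Σ_{k=1}^{N−1} sin(2πkj/N) / sin⁴(kπ/N) = 0`,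
`j = 0, …, N − 1`,
and particularly
`Σ_{k=1}^{N−1} 1/sin²(kπ/N) = (N² − 1)/3`, `Σ_{k=1}^{N−1} 1/sin⁴(kπ/N) = (N² − 1)(N² + 11)/(45N)`."
(The last right-hand side is a misprint of the arXiv text for `(N² − 1)(N² + 11)/45`, the
`j = 0` case of the second identity: for `N = 2` the sum is `1/sin⁴(π/2) = 1 = 3·15/45`.)

Proof (verbatim, abridged): "Since `A` in (2.1) resp. `A²` are circulant matrices, they can be
diagonalized by the Fourier matrix `F_N = N^{−1/2}(ω_N^{jk})_{j,k=0}^{N−1}`, where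
`ω_N := e^{−2πi/N}`. […] `a(ω_N^k) = −2 + 2cos(2πk/N) = −4 sin²(πk/N)` […] we obtain the circulant
matrix `A⁺ = F_N^* Â⁺ F_N` with `Â⁺ := diag(0, −1/(4 sin²(π/N)), …, −1/(4 sin²((N−1)π/N)))`.
Analogously, […] `(A²)⁺ = F_N^* (Â⁺)² F_N`.  A comparison of the entries `a⁺_j` (resp. `c⁺_j`)
in the first column of `F_N^* Â⁺ F_N` (resp. `F_N^* (Â⁺)² F_N`),
`a⁺_j = (1/N) Σ_{k=1}^{N−1} (−1/(4 sin²(πk/N))) ω_N^{−jk} ω_N^{k0}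
= (1/N) Σ_{k=1}^{N−1} −(cos(2πkj/N) + i sin(2πkj/N)) / (4 sin²(kπ/N))` resp.
`c⁺_j = (1/N) Σ_{k=1}^{N−1} −(cos(2πkj/N) + i sin(2πkj/N)) / (16 sin⁴(kπ/N))`,
with the formulas found for `A⁺` (resp. `(A²)⁺`) in Theorems 2.2 and 2.3 yields the assertions."

## What is formalised

CONVENTIONS (as in `CirculantPseudoinverseDFT`): `F = fourierMatrix N` is the tree's unnormalised
DFT matrix (`F_{jk} = ζ_k^j`, `ζ_k = cycleRoot N k = e^{2πik/N}`, `Fᴴ F = N·1`), so PHW's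
`F_N^* D F_N` reads `N⁻¹ · F D Fᴴ`; `Δ = laplaceP ℂ N = circ(2, −1, 0, …, 0, −1) = −A`
(`QTTLaplace`, VR2022's stiffness matrix), hence `A⁺ = −Δ⁺` (`pinv_neg`) and `A² = Δ²`;
Lean's `0⁻¹ = 0` is the pseudo-inversion of the `k = 0` eigenvalue.

* §A (the proof of Cor. 2.4 for `Δ = laplaceP`, all `N ≥ 1`): `laplaceP K N =
  circulant (cycleLapVec K N)` over any commutative ring (`lapPCol_eq_cycleLapVec`,
  `laplaceP_eq_circulant_cycleLapVec`); the symbol `4 sin²(πk/N)` (`circulantEig_lapPCol`);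
  "`Â = F_N A F_N^*`": `Δ = N⁻¹ · F diag(4 sin²(πk/N)) Fᴴ`,
  `A = −Δ = N⁻¹ · F diag(−4 sin²(πk/N)) Fᴴ` (`laplaceP_eq_fourier_conj`,
  `neg_laplaceP_eq_fourier_conj`); "`A⁺ = F_N^* Â⁺ F_N`":
  `Δ⁺ = N⁻¹ · F diag((4 sin²(πk/N))⁻¹) Fᴴ` and, verbatim, `A⁺ = N⁻¹ · F diag((−4 sin²(πk/N))⁻¹) Fᴴ`
  (`pinv_laplaceP_eq_fourier_conj`, `pinv_neg_laplaceP_eq_fourier_conj`);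
  "`(A²)⁺ = F_N^* (Â⁺)² F_N`" (`pinv_laplaceP_sq_eq_fourier_conj`,
  `pinv_neg_laplaceP_mul_neg_laplaceP_eq_fourier_conj`); the first columns `a⁺_j`, `c⁺_j` as the
  DFT sums `N⁻¹ Σ_k (4 sin²(πk/N))⁻¹ ζ_k^j`, `N⁻¹ Σ_k (4 sin²(πk/N))⁻² ζ_k^j`
  (`pinv_laplaceP_apply_zero_eq_sum`, `pinv_laplaceP_sq_apply_zero_eq_sum`).
* §B ("a comparison … with the formulas found in Theorems 2.2 and 2.3"): the closed forms
  `Σ_{k : Fin N} (4 sin²(πk/N))⁻¹ ζ_k^j = (6j² − 6Nj + N² − 1)/12` and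
  `Σ_{k : Fin N} (4 sin²(πk/N))⁻² ζ_k^j = (N² − 1)(N² + 11)/720 − j(N − j)(Nj − j² + 2)/24`
  (`sum_inv_four_sin_sq_mul_cycleRoot_pow`, `sum_inv_four_sin_sq_sq_mul_cycleRoot_pow`), the
  quartic one in PHW's exponential form over `k = 1, …, N − 1`
  (`sum_Ico_exp_div_sixteen_sin_pow_four`), and COROLLARY 2.4 itself: the two cosine identities
  (`sum_Ico_cos_div_sin_sq`, `sum_Ico_cos_div_sin_pow_four`), the two vanishing sine sums
  (`sum_Ico_sin_div_sin_sq`, `sum_Ico_sin_div_sin_pow_four`) — each for `j < N` — and the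
  "particularly" identity `Σ_{k=1}^{N−1} 1/sin⁴(kπ/N) = (N² − 1)(N² + 11)/45` for every `N ≥ 1`
  (`sum_Ico_inv_sin_pow_four`).

Not re-filed: the sin² "particularly" identity `Σ_{k=1}^{N−1} 1/sin²(kπ/N) = (N² − 1)/3` and the
exponential form of the first identity are already in the tree as Dick–Pillichshammer 2010
Cor. A.23 (`Literature.Analysis.Quadrature.sum_inv_sin_sq_eq`, `sum_exp_div_sin_sq_eq`, for
`1 < N`); here the first is the `j = 0` case of `sum_Ico_cos_div_sin_sq`.  PHW's Faulhaber /
Bernoulli-polynomial route (proof of Thm. 2.3) is replaced by the closed forms of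
`QTTLaplacePseudoinverse`.

AI-produced formalisation (H21 engines group, seat eng-quad-2, 2026-08-24); statements checked
against the arXiv text; no facts, no axioms beyond Mathlib's, no placeholders.
-/

open Matrix Finset
open scoped Real

namespace Literature.LinearAlgebra.TensorNetworks

open Literature.LinearAlgebra.Matrix Literature.LinearAlgebra.Matrix.MoorePenrose
  Literature.Combinatorics.SimpleGraph

variable {N : ℕ}

/-! ## A. `Δ = laplaceP` as the circulant `circ(2, −1, 0, …, 0, −1)` and its Fourier form -/

section LaplacianDFT

/-- The first column `2e₀ − e₁ − e₋₁` of `Δ = laplaceP` (`lapPCol`) is `CirculantDFT`'s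
cycle-Laplacian column `cycleLapVec` (all `N ≥ 1`, including the degenerate `N = 1, 2` where the
Kronecker deltas overlap; PHW's `A = circ(−2, 1, 0, …, 0, 1)`).
[cite: PlonkaHoffmannWeickert2016, Thm. 2.2] -/
theorem lapPCol_eq_cycleLapVec (K : Type*) [CommRing K] (N : ℕ) [NeZero N] :
    lapPCol K N = cycleLapVec K N := by
  funext d
  simp only [lapPCol, cycleLapVec, cycleAdjVec, Pi.sub_apply, Pi.add_apply, Pi.single_apply]
  ring

/-- `Δ = circ(2, −1, 0, …, 0, −1)` as the circulant of `cycleLapVec` ("`A` in (2.1) is a circulant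
matrix"), over any commutative ring.  [cite: PlonkaHoffmannWeickert2016, Cor. 2.4 (proof)] -/
theorem laplaceP_eq_circulant_cycleLapVec (K : Type*) [CommRing K] (N : ℕ) [NeZero N] :
    laplaceP K N = circulant (cycleLapVec K N) := by
  rw [laplaceP_eq_circulant, lapPCol_eq_cycleLapVec]

/-- "`a(ω_N^k) = −2 + e^{−2πik/N} + e^{2πik/N} = −2 + 2cos(2πk/N) = −4 sin²(πk/N)`,
`k = 0, …, N − 1`" — for `Δ = −A`: the eigenvalue of `Δ` on the `k`-th Fourier mode is
`4 sin²(πk/N)`.  [cite: PlonkaHoffmannWeickert2016, Cor. 2.4 (proof)] -/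
theorem circulantEig_lapPCol [NeZero N] (k : Fin N) :
    circulantEig (lapPCol ℂ N) k = ((4 * Real.sin (π * (k : ℕ) / N) ^ 2 : ℝ) : ℂ) := by
  rw [lapPCol_eq_cycleLapVec]
  exact circulantEig_cycleLapVec_eq_sin_sq k

/-- "`Â = F_N A F_N^* = diag(a(ω_N^k))`" — for `Δ = −A` in the tree's normalisation:
`Δ = N⁻¹ · F diag(4 sin²(πk/N)) Fᴴ`.  [cite: PlonkaHoffmannWeickert2016, Cor. 2.4 (proof)] -/
theorem laplaceP_eq_fourier_conj (N : ℕ) [NeZero N] :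
    laplaceP ℂ N =
      (N : ℂ)⁻¹ • (fourierMatrix N *
        diagonal (fun k : Fin N => ((4 * Real.sin (π * (k : ℕ) / N) ^ 2 : ℝ) : ℂ)) *
          (fourierMatrix N)ᴴ) := by
  rw [laplaceP_eq_circulant_cycleLapVec]
  exact circulant_cycleLapVec_eq_fourier_conj N

/-- "`Â = F_N A F_N^* = diag(a(ω_N^k))`, `a(ω_N^k) = −4 sin²(πk/N)`" verbatim, for PHW's
`A = circ(−2, 1, 0, …, 0, 1) = −Δ`: `A = N⁻¹ · F diag(−4 sin²(πk/N)) Fᴴ`.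
[cite: PlonkaHoffmannWeickert2016, Cor. 2.4 (proof)] -/
theorem neg_laplaceP_eq_fourier_conj (N : ℕ) [NeZero N] :
    -laplaceP ℂ N =
      (N : ℂ)⁻¹ • (fourierMatrix N *
        diagonal (fun k : Fin N => ((-(4 * Real.sin (π * (k : ℕ) / N) ^ 2) : ℝ) : ℂ)) *
          (fourierMatrix N)ᴴ) := by
  rw [laplaceP_eq_circulant_cycleLapVec]
  exact neg_circulant_cycleLapVec_eq_fourier_conj N

/-- **`Δ⁺ = N⁻¹ · F diag((4 sin²(πk/N))⁺) Fᴴ`** — PHW's "`A⁺ = F_N^* Â⁺ F_N`,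
`Â⁺ = diag(0, −1/(4 sin²(π/N)), …, −1/(4 sin²((N−1)π/N)))`" for the stiffness matrix `Δ = −A`
(the `k = 0` entry is `(4 sin² 0)⁻¹ = 0⁻¹ = 0`).
[cite: PlonkaHoffmannWeickert2016, Cor. 2.4 (proof)] -/
theorem pinv_laplaceP_eq_fourier_conj (N : ℕ) [NeZero N] :
    pinv (laplaceP ℂ N) =
      (N : ℂ)⁻¹ • (fourierMatrix N *
        diagonal (fun k : Fin N => (((4 * Real.sin (π * (k : ℕ) / N) ^ 2)⁻¹ : ℝ) : ℂ)) *
          (fourierMatrix N)ᴴ) := by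
  rw [laplaceP_eq_circulant_cycleLapVec]
  exact pinv_circulant_cycleLapVec_eq_fourier_conj N

/-- COROLLARY 2.4 (proof) as printed, for `A = circ(−2, 1, 0, …, 0, 1) = −Δ`:
"we obtain the circulant matrix `A⁺ = F_N^* Â⁺ F_N` with `Â⁺ := diag(0, −1/(4 sin²(π/N)),
−1/(4 sin²(2π/N)), …, −1/(4 sin²((N−1)π/N)))`" (in the tree's normalisation
`F_N^* D F_N = N⁻¹ · F D Fᴴ`; the `k = 0` entry `(−4 sin² 0)⁻¹ = 0`).
[cite: PlonkaHoffmannWeickert2016, Cor. 2.4 (proof)] -/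
theorem pinv_neg_laplaceP_eq_fourier_conj (N : ℕ) [NeZero N] :
    pinv (-laplaceP ℂ N) =
      (N : ℂ)⁻¹ • (fourierMatrix N *
        diagonal (fun k : Fin N => (((-(4 * Real.sin (π * (k : ℕ) / N) ^ 2))⁻¹ : ℝ) : ℂ)) *
          (fourierMatrix N)ᴴ) := by
  rw [laplaceP_eq_circulant_cycleLapVec]
  exact pinv_neg_circulant_cycleLapVec_eq_fourier_conj N

/-- "Analogously, the Moore–Penrose inverse of `A²` can be written as
`(A²)⁺ = F_N^* (Â⁺)² F_N`": `(Δ²)⁺ = N⁻¹ · F diag((4 sin²(πk/N))⁻²) Fᴴ` (`Δ² = A²`).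
[cite: PlonkaHoffmannWeickert2016, Cor. 2.4 (proof)] -/
theorem pinv_laplaceP_sq_eq_fourier_conj (N : ℕ) [NeZero N] :
    pinv (laplaceP ℂ N * laplaceP ℂ N) =
      (N : ℂ)⁻¹ • (fourierMatrix N *
        diagonal (fun k : Fin N => (((4 * Real.sin (π * (k : ℕ) / N) ^ 2)⁻¹ ^ 2 : ℝ) : ℂ)) *
          (fourierMatrix N)ᴴ) := by
  rw [laplaceP_eq_circulant_cycleLapVec]
  exact pinv_circulant_cycleLapVec_mul_self_eq_fourier_conj N

/-- "`(A²)⁺ = F_N^* (Â⁺)² F_N`" verbatim for `A = −Δ`, with `(Â⁺)² = diag((−4 sin²(πk/N))⁻²)`.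
[cite: PlonkaHoffmannWeickert2016, Cor. 2.4 (proof)] -/
theorem pinv_neg_laplaceP_mul_neg_laplaceP_eq_fourier_conj (N : ℕ) [NeZero N] :
    pinv (-laplaceP ℂ N * -laplaceP ℂ N) =
      (N : ℂ)⁻¹ • (fourierMatrix N *
        diagonal (fun k : Fin N => (((-(4 * Real.sin (π * (k : ℕ) / N) ^ 2))⁻¹ ^ 2 : ℝ) : ℂ)) *
          (fourierMatrix N)ᴴ) := by
  rw [laplaceP_eq_circulant_cycleLapVec]
  exact pinv_neg_circulant_cycleLapVec_mul_self_eq_fourier_conj N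

/-- The first column of `Δ⁺ = −A⁺` as a DFT sum: "`a⁺_j = (1/N) Σ_k â⁺_k ω_N^{−jk} ω_N^{k0}`",
i.e. `(Δ⁺)_{j0} = N⁻¹ Σ_{k : Fin N} (4 sin²(πk/N))⁻¹ ζ_k^j`.
[cite: PlonkaHoffmannWeickert2016, Cor. 2.4 (proof)] -/
theorem pinv_laplaceP_apply_zero_eq_sum [NeZero N] (j : Fin N) :
    pinv (laplaceP ℂ N) j 0 =
      (N : ℂ)⁻¹ * ∑ k : Fin N, (((4 * Real.sin (π * (k : ℕ) / N) ^ 2)⁻¹ : ℝ) : ℂ) *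
        cycleRoot N k ^ (j : ℕ) := by
  rw [laplaceP_eq_circulant_cycleLapVec]
  exact pinv_circulant_cycleLapVec_apply_zero j

/-- The first column of `(Δ²)⁺ = (A²)⁺` as a DFT sum: "`c⁺_j`" `= −N⁻¹ Σ_k (4 sin²(πk/N))⁻² ζ_k^j`,
i.e. `((Δ²)⁺)_{j0} = N⁻¹ Σ_{k : Fin N} (4 sin²(πk/N))⁻² ζ_k^j`.
[cite: PlonkaHoffmannWeickert2016, Cor. 2.4 (proof)] -/
theorem pinv_laplaceP_sq_apply_zero_eq_sum [NeZero N] (j : Fin N) :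
    pinv (laplaceP ℂ N * laplaceP ℂ N) j 0 =
      (N : ℂ)⁻¹ * ∑ k : Fin N, (((4 * Real.sin (π * (k : ℕ) / N) ^ 2)⁻¹ ^ 2 : ℝ) : ℂ) *
        cycleRoot N k ^ (j : ℕ) := by
  rw [laplaceP_eq_circulant_cycleLapVec]
  exact pinv_circulant_cycleLapVec_mul_self_apply_zero j

end LaplacianDFT

/-! ## B. COROLLARY 2.4 of [PHW16]: the comparison with Theorems 2.2–2.3 and the identities -/

section TrigonometricSums

/-- "A comparison of the entries `a⁺_j` in the first column of `F_N^* Â⁺ F_N` … with the formula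
found for `A⁺` in Theorem 2.2": entry `(j, 0)` of `Δ⁺` computed both ways gives
`Σ_{k : Fin N} (4 sin²(πk/N))⁺ ζ_k^j = (6j² − 6Nj + N² − 1)/12`.
[cite: PlonkaHoffmannWeickert2016, Cor. 2.4 (proof)] -/
theorem sum_inv_four_sin_sq_mul_cycleRoot_pow [NeZero N] (j : Fin N) :
    ∑ k : Fin N, (((4 * Real.sin (π * (k : ℕ) / N) ^ 2)⁻¹ : ℝ) : ℂ) * cycleRoot N k ^ (j : ℕ) =
      (6 * ((j : ℕ) : ℂ) ^ 2 - 6 * N * (j : ℕ) + (N : ℂ) ^ 2 - 1) / 12 := by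
  have hN : (N : ℂ) ≠ 0 := Nat.cast_ne_zero.mpr (NeZero.ne N)
  have h2 : pinv (laplaceP ℂ N) j 0 =
      (6 * ((j : ℕ) : ℂ) ^ 2 - 6 * N * (j : ℕ) + (N : ℂ) ^ 2 - 1) / (12 * N) := by
    rw [pinv_laplaceP_apply, sub_zero]
  have h := (pinv_laplaceP_apply_zero_eq_sum j).symm.trans h2
  calc ∑ k : Fin N, (((4 * Real.sin (π * (k : ℕ) / N) ^ 2)⁻¹ : ℝ) : ℂ) * cycleRoot N k ^ (j : ℕ)
      = N * ((N : ℂ)⁻¹ * ∑ k : Fin N, (((4 * Real.sin (π * (k : ℕ) / N) ^ 2)⁻¹ : ℝ) : ℂ) *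
          cycleRoot N k ^ (j : ℕ)) := by rw [← mul_assoc, mul_inv_cancel₀ hN, one_mul]
    _ = N * ((6 * ((j : ℕ) : ℂ) ^ 2 - 6 * N * (j : ℕ) + (N : ℂ) ^ 2 - 1) / (12 * N)) := by rw [h]
    _ = (6 * ((j : ℕ) : ℂ) ^ 2 - 6 * N * (j : ℕ) + (N : ℂ) ^ 2 - 1) / 12 := by
          field_simp

/-- The same comparison for `(Δ²)⁺ = (A²)⁺` and Theorem 2.3 (`c⁺_j`):
`Σ_{k : Fin N} ((4 sin²(πk/N))⁺)² ζ_k^j = (N² − 1)(N² + 11)/720 − j(N − j)(Nj − j² + 2)/24`.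
[cite: PlonkaHoffmannWeickert2016, Cor. 2.4 (proof)] -/
theorem sum_inv_four_sin_sq_sq_mul_cycleRoot_pow [NeZero N] (j : Fin N) :
    ∑ k : Fin N, (((4 * Real.sin (π * (k : ℕ) / N) ^ 2)⁻¹ ^ 2 : ℝ) : ℂ) * cycleRoot N k ^ (j : ℕ) =
      ((N : ℂ) ^ 2 - 1) * ((N : ℂ) ^ 2 + 11) / 720 -
        ((j : ℕ) : ℂ) * (N - (j : ℕ)) * (N * (j : ℕ) - ((j : ℕ) : ℂ) ^ 2 + 2) / 24 := by
  have hN : (N : ℂ) ≠ 0 := Nat.cast_ne_zero.mpr (NeZero.ne N)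
  have h2 : pinv (laplaceP ℂ N * laplaceP ℂ N) j 0 =
      ((N : ℂ) ^ 2 - 1) * ((N : ℂ) ^ 2 + 11) / (720 * N) -
        ((j : ℕ) : ℂ) * (N - (j : ℕ)) * (N * (j : ℕ) - ((j : ℕ) : ℂ) ^ 2 + 2) / (24 * N) := by
    rw [pinv_laplaceP_sq, circulant_apply, sub_zero]
    rfl
  have h := (pinv_laplaceP_sq_apply_zero_eq_sum j).symm.trans h2
  calc ∑ k : Fin N, (((4 * Real.sin (π * (k : ℕ) / N) ^ 2)⁻¹ ^ 2 : ℝ) : ℂ) * cycleRoot N k ^ (j : ℕ)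
      = N * ((N : ℂ)⁻¹ * ∑ k : Fin N, (((4 * Real.sin (π * (k : ℕ) / N) ^ 2)⁻¹ ^ 2 : ℝ) : ℂ) *
          cycleRoot N k ^ (j : ℕ)) := by rw [← mul_assoc, mul_inv_cancel₀ hN, one_mul]
    _ = N * (((N : ℂ) ^ 2 - 1) * ((N : ℂ) ^ 2 + 11) / (720 * N) -
        ((j : ℕ) : ℂ) * (N - (j : ℕ)) * (N * (j : ℕ) - ((j : ℕ) : ℂ) ^ 2 + 2) / (24 * N)) := by
          rw [h]
    _ = ((N : ℂ) ^ 2 - 1) * ((N : ℂ) ^ 2 + 11) / 720 -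
        ((j : ℕ) : ℂ) * (N - (j : ℕ)) * (N * (j : ℕ) - ((j : ℕ) : ℂ) ^ 2 + 2) / 24 := by
          field_simp

/-- `ζ_k^j = e^{2πi kj/N}` (`ω_N^{−jk}` for PHW's `ω_N = e^{−2πi/N}`).  [folklore] -/
private theorem cycleRoot_pow_eq_exp (k : Fin N) (j : ℕ) :
    cycleRoot N k ^ j = Complex.exp ((2 * π * (k : ℕ) * j / N : ℝ) * Complex.I) := by
  rw [cycleRoot, ← Complex.exp_nat_mul, cycleAngle]
  congr 1
  push_cast
  ring

/-- The summand of `Δ⁺`'s first column in exponential form.  [folklore] -/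
private theorem inv_four_sin_sq_mul_cycleRoot_pow (k : Fin N) (j : ℕ) :
    (((4 * Real.sin (π * (k : ℕ) / N) ^ 2)⁻¹ : ℝ) : ℂ) * cycleRoot N k ^ j =
      Complex.exp ((2 * π * (k : ℕ) * j / N : ℝ) * Complex.I) /
        ((4 * Real.sin (π * (k : ℕ) / N) ^ 2 : ℝ) : ℂ) := by
  rw [cycleRoot_pow_eq_exp, Complex.ofReal_inv, inv_mul_eq_div]

/-- The summand of `(Δ²)⁺`'s first column in exponential form (`(4 sin²)² = 16 sin⁴`).
[folklore] -/
private theorem inv_four_sin_sq_sq_mul_cycleRoot_pow (k : Fin N) (j : ℕ) :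
    (((4 * Real.sin (π * (k : ℕ) / N) ^ 2)⁻¹ ^ 2 : ℝ) : ℂ) * cycleRoot N k ^ j =
      Complex.exp ((2 * π * (k : ℕ) * j / N : ℝ) * Complex.I) /
        ((16 * Real.sin (π * (k : ℕ) / N) ^ 4 : ℝ) : ℂ) := by
  have h16 : ((4 * Real.sin (π * (k : ℕ) / N) ^ 2)⁻¹ ^ 2 : ℝ) =
      (16 * Real.sin (π * (k : ℕ) / N) ^ 4)⁻¹ := by
    rw [inv_pow]
    congr 1
    ring
  rw [h16, cycleRoot_pow_eq_exp, Complex.ofReal_inv, inv_mul_eq_div]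

/-- "`a⁺_j = (1/N) Σ_{k=1}^{N−1} (−1/(4 sin²(πk/N))) ω_N^{−jk} ω_N^{k0}`" compared with Theorem 2.2
(`Δ = −A`): `Σ_{k=1}^{N−1} e^{2πikj/N} / (4 sin²(πk/N)) = (6j² − 6Nj + N² − 1)/12` for `j < N`
(the `k = 0` mode drops out as `(4 sin² 0)⁺ = 0`).  Private: up to the factor `4` this is
Dick–Pillichshammer's Cor. A.23, in the tree as
`Literature.Analysis.Quadrature.sum_exp_div_sin_sq_eq`.
[cite: PlonkaHoffmannWeickert2016, Cor. 2.4 (proof)] -/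
private theorem sum_Ico_exp_div_four_sin_sq {N j : ℕ} (hj : j < N) :
    ∑ k ∈ Ico 1 N, Complex.exp ((2 * π * k * j / N : ℝ) * Complex.I) /
        ((4 * Real.sin (π * k / N) ^ 2 : ℝ) : ℂ) =
      (((6 * j ^ 2 - 6 * N * j + N ^ 2 - 1) / 12 : ℝ) : ℂ) := by
  haveI : NeZero N := ⟨by omega⟩
  set g : ℕ → ℂ := fun k => Complex.exp ((2 * π * k * j / N : ℝ) * Complex.I) /
    ((4 * Real.sin (π * k / N) ^ 2 : ℝ) : ℂ) with hg
  have h1 : ∑ k ∈ range N, g k =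
      (6 * ((j : ℕ) : ℂ) ^ 2 - 6 * N * (j : ℕ) + (N : ℂ) ^ 2 - 1) / 12 := by
    rw [← Fin.sum_univ_eq_sum_range, ← sum_inv_four_sin_sq_mul_cycleRoot_pow ⟨j, hj⟩]
    refine Finset.sum_congr rfl fun k _ => ?_
    simp only [hg]
    exact (inv_four_sin_sq_mul_cycleRoot_pow k j).symm
  have g0 : g 0 = 0 := by simp [hg]
  rw [range_eq_Ico, sum_eq_sum_Ico_succ_bot (NeZero.pos N), g0, zero_add] at h1
  rw [h1]
  push_cast
  ring

/-- "`c⁺_j = (1/N) Σ_{k=1}^{N−1} −(cos(2πkj/N) + i sin(2πkj/N)) / (16 sin⁴(kπ/N))`" compared with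
Theorem 2.3 (`Δ² = A²`, `g = −c⁺`): `Σ_{k=1}^{N−1} e^{2πikj/N} / (16 sin⁴(πk/N))
= (N² − 1)(N² + 11)/720 − j(N − j)(Nj − j² + 2)/24` for `j < N`.
[cite: PlonkaHoffmannWeickert2016, Cor. 2.4 (proof)] -/
theorem sum_Ico_exp_div_sixteen_sin_pow_four {N j : ℕ} (hj : j < N) :
    ∑ k ∈ Ico 1 N, Complex.exp ((2 * π * k * j / N : ℝ) * Complex.I) /
        ((16 * Real.sin (π * k / N) ^ 4 : ℝ) : ℂ) =
      ((((N : ℝ) ^ 2 - 1) * ((N : ℝ) ^ 2 + 11) / 720 -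
        j * (N - j) * (N * j - (j : ℝ) ^ 2 + 2) / 24 : ℝ) : ℂ) := by
  haveI : NeZero N := ⟨by omega⟩
  set g : ℕ → ℂ := fun k => Complex.exp ((2 * π * k * j / N : ℝ) * Complex.I) /
    ((16 * Real.sin (π * k / N) ^ 4 : ℝ) : ℂ) with hg
  have h1 : ∑ k ∈ range N, g k = ((N : ℂ) ^ 2 - 1) * ((N : ℂ) ^ 2 + 11) / 720 -
      ((j : ℕ) : ℂ) * (N - (j : ℕ)) * (N * (j : ℕ) - ((j : ℕ) : ℂ) ^ 2 + 2) / 24 := by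
    rw [← Fin.sum_univ_eq_sum_range, ← sum_inv_four_sin_sq_sq_mul_cycleRoot_pow ⟨j, hj⟩]
    refine Finset.sum_congr rfl fun k _ => ?_
    simp only [hg]
    exact (inv_four_sin_sq_sq_mul_cycleRoot_pow k j).symm
  have g0 : g 0 = 0 := by simp [hg]
  rw [range_eq_Ico, sum_eq_sum_Ico_succ_bot (NeZero.pos N), g0, zero_add] at h1
  rw [h1]
  push_cast
  ring

/-- **COROLLARY 2.4 of [PHW16], first identity**:
`Σ_{k=1}^{N−1} cos(2πkj/N) / sin²(kπ/N) = (N² − 1)/3 − 2j(N − j)`, `j = 0, …, N − 1`.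
(Dick–Pillichshammer 2010 Cor. A.23 states the exponential form for `|l| < N`; in the tree as
`Literature.Analysis.Quadrature.sum_exp_div_sin_sq_eq`.)
[cite: PlonkaHoffmannWeickert2016, Cor. 2.4] -/
theorem sum_Ico_cos_div_sin_sq {N j : ℕ} (hj : j < N) :
    ∑ k ∈ Ico 1 N, Real.cos (2 * π * k * j / N) / Real.sin (π * k / N) ^ 2 =
      ((N : ℝ) ^ 2 - 1) / 3 - 2 * j * (N - j) := by
  have h := congrArg Complex.re (sum_Ico_exp_div_four_sin_sq hj)
  rw [Complex.re_sum, Complex.ofReal_re] at h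
  simp only [Complex.div_ofReal_re, Complex.exp_ofReal_mul_I_re] at h
  have h4 : ∑ k ∈ Ico 1 N, Real.cos (2 * π * k * j / N) / Real.sin (π * k / N) ^ 2 =
      4 * ∑ k ∈ Ico 1 N, Real.cos (2 * π * k * j / N) / (4 * Real.sin (π * k / N) ^ 2) := by
    rw [mul_sum]
    refine Finset.sum_congr rfl fun k _ => ?_
    rw [← mul_div_assoc, mul_div_mul_left _ _ four_ne_zero]
  rw [h4, h]
  ring

/-- **COROLLARY 2.4 of [PHW16], second identity**:
`Σ_{k=1}^{N−1} cos(2πkj/N) / sin⁴(kπ/N) = (N² − 1)(N² + 11)/45 − 2j(N − j)(Nj − j² + 2)/3`,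
`j = 0, …, N − 1`.  [cite: PlonkaHoffmannWeickert2016, Cor. 2.4] -/
theorem sum_Ico_cos_div_sin_pow_four {N j : ℕ} (hj : j < N) :
    ∑ k ∈ Ico 1 N, Real.cos (2 * π * k * j / N) / Real.sin (π * k / N) ^ 4 =
      ((N : ℝ) ^ 2 - 1) * ((N : ℝ) ^ 2 + 11) / 45 -
        2 * j * (N - j) * (N * j - (j : ℝ) ^ 2 + 2) / 3 := by
  have h := congrArg Complex.re (sum_Ico_exp_div_sixteen_sin_pow_four hj)
  rw [Complex.re_sum, Complex.ofReal_re] at h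
  simp only [Complex.div_ofReal_re, Complex.exp_ofReal_mul_I_re] at h
  have h16 : ∑ k ∈ Ico 1 N, Real.cos (2 * π * k * j / N) / Real.sin (π * k / N) ^ 4 =
      16 * ∑ k ∈ Ico 1 N, Real.cos (2 * π * k * j / N) / (16 * Real.sin (π * k / N) ^ 4) := by
    rw [mul_sum]
    refine Finset.sum_congr rfl fun k _ => ?_
    rw [← mul_div_assoc, mul_div_mul_left _ _ (by norm_num : (16 : ℝ) ≠ 0)]
  rw [h16, h]
  ring

/-- **COROLLARY 2.4 of [PHW16], third identity (first half)**:
`Σ_{k=1}^{N−1} sin(2πkj/N) / sin²(kπ/N) = 0`, `j = 0, …, N − 1`.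
[cite: PlonkaHoffmannWeickert2016, Cor. 2.4] -/
theorem sum_Ico_sin_div_sin_sq {N j : ℕ} (hj : j < N) :
    ∑ k ∈ Ico 1 N, Real.sin (2 * π * k * j / N) / Real.sin (π * k / N) ^ 2 = 0 := by
  have h := congrArg Complex.im (sum_Ico_exp_div_four_sin_sq hj)
  rw [Complex.im_sum, Complex.ofReal_im] at h
  simp only [Complex.div_ofReal_im, Complex.exp_ofReal_mul_I_im] at h
  have h4 : ∑ k ∈ Ico 1 N, Real.sin (2 * π * k * j / N) / Real.sin (π * k / N) ^ 2 =
      4 * ∑ k ∈ Ico 1 N, Real.sin (2 * π * k * j / N) / (4 * Real.sin (π * k / N) ^ 2) := by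
    rw [mul_sum]
    refine Finset.sum_congr rfl fun k _ => ?_
    rw [← mul_div_assoc, mul_div_mul_left _ _ four_ne_zero]
  rw [h4, h, mul_zero]

/-- **COROLLARY 2.4 of [PHW16], third identity (second half)**:
`Σ_{k=1}^{N−1} sin(2πkj/N) / sin⁴(kπ/N) = 0`, `j = 0, …, N − 1`.
[cite: PlonkaHoffmannWeickert2016, Cor. 2.4] -/
theorem sum_Ico_sin_div_sin_pow_four {N j : ℕ} (hj : j < N) :
    ∑ k ∈ Ico 1 N, Real.sin (2 * π * k * j / N) / Real.sin (π * k / N) ^ 4 = 0 := by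
  have h := congrArg Complex.im (sum_Ico_exp_div_sixteen_sin_pow_four hj)
  rw [Complex.im_sum, Complex.ofReal_im] at h
  simp only [Complex.div_ofReal_im, Complex.exp_ofReal_mul_I_im] at h
  have h16 : ∑ k ∈ Ico 1 N, Real.sin (2 * π * k * j / N) / Real.sin (π * k / N) ^ 4 =
      16 * ∑ k ∈ Ico 1 N, Real.sin (2 * π * k * j / N) / (16 * Real.sin (π * k / N) ^ 4) := by
    rw [mul_sum]
    refine Finset.sum_congr rfl fun k _ => ?_
    rw [← mul_div_assoc, mul_div_mul_left _ _ (by norm_num : (16 : ℝ) ≠ 0)]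
  rw [h16, h, mul_zero]

/-- **COROLLARY 2.4 of [PHW16], "and particularly"** (the `j = 0` case of the second identity):
`Σ_{k=1}^{N−1} 1/sin⁴(kπ/N) = (N² − 1)(N² + 11)/45` for every `N ≥ 1` (the arXiv text misprints
the right-hand side as `(N² − 1)(N² + 11)/(45N)`; for `N = 2` the sum is `1`).  The sin²
companion `Σ 1/sin²(kπ/N) = (N² − 1)/3` is `Literature.Analysis.Quadrature.sum_inv_sin_sq_eq`
(Dick–Pillichshammer Cor. A.23) and the `j = 0` case of `sum_Ico_cos_div_sin_sq`.
[cite: PlonkaHoffmannWeickert2016, Cor. 2.4] -/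
theorem sum_Ico_inv_sin_pow_four (N : ℕ) [NeZero N] :
    ∑ k ∈ Ico 1 N, 1 / Real.sin (π * k / N) ^ 4 = ((N : ℝ) ^ 2 - 1) * ((N : ℝ) ^ 2 + 11) / 45 := by
  have h := sum_Ico_cos_div_sin_pow_four (N := N) (j := 0) (NeZero.pos N)
  simp only [Nat.cast_zero, mul_zero, zero_div, Real.cos_zero, zero_mul, sub_zero] at h
  exact h

end TrigonometricSums

end Literature.LinearAlgebra.TensorNetworks
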